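import Literature.NumberTheory.GaloisRepresentations.GSpValued
import Literature.NumberTheory.GaloisRepresentations.SymplecticMultiplier
import HarnessLib

/-!
# Symplectic-with-multiplier representations have a standard form (proofs)

Topic `NumberTheory/GaloisRepresentations`; `…Proofs` companion (theorems only) of
`SymplecticMultiplier` and `GSpValued`.

The tree's hypothesis-level predicate `FramedGaloisRep.IsSymplecticWithMultiplierFun ρ ν`
(`SymplecticMultiplier`: `ρ(g)ᵀ J ρ(g) = ν(g) J` for SOME skew-symmetric `J` with `det J ∈ kˣ`)
quantifies over the Gram matrix, whereas the literature fixes one: `GSp_{2m}` is the similitude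
group of a standard alternating form (Mathlib: `Matrix.J (Fin m) k = (0 -1ₘ; 1ₘ 0)`,
`Matrix.symplecticGroup`; BCGP 2025 §1.8.6: `J = (0 S; -S 0)`).  Over a field with `2 ≠ 0` the
two agree up to the frame: `ρ` is symplectic with multiplier `ν` iff some `GL_{2m}`-conjugate
`P⁻¹ ρ P`, re-indexed by `Fin m ⊕ Fin m ≃ Fin (m + m)` (`finSumFinEquiv`), is a similitude of
Mathlib's `Matrix.J (Fin m) k` with multiplier `ν(g)` for every `g`
(`FramedGaloisRep.isSymplecticWithMultiplierFun_iff_exists_conj_isSimilitude_matrixJ`), by the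
symplectic basis theorem in the tree's form `exists_transpose_mul_mul_eq_neg_J`
(`GSpValued`; McDuff–Salamon, Thm. 2.1.3).  The rank-`4` instance with BCGP's antidiagonal `J` is
`FramedGaloisRep.isSymplecticWithMultiplierFun_iff_exists_conj_isSimilitude_bcgpJ`
(`DiophantineGeometry/BcgpSwitchExistsModularAbelianSurfaceProofs`, Part 5).  Appended: the comparison
with `FramedRep.IsGSpValued` (`isGSpValued_iff_exists_isSymplecticWithMultiplierFun`,
`isGSpValued_iff_exists_conj_isSimilitude_matrixJ`).

## References

* [McDuffSalamon2017] D. McDuff, D. Salamon, *Introduction to Symplectic Topology*, 3rd ed.,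
  Thm. 2.1.3 (symplectic bases).
* [BoxerEtAl2021] G. Boxer, F. Calegari, T. Gee, V. Pilloni, *Abelian surfaces over totally real
  fields are potentially modular*, Publ. Math. IHÉS 134 (2021), §2.1.1 (`GSp₄`, similitude `ν`).
-/

noncomputable section

open Matrix Field

namespace Literature.NumberTheory.GaloisRepresentations

variable {ι : Type*} [Fintype ι] [DecidableEq ι] {R : Type*} [CommRing R]

omit [DecidableEq ι] in
/-- A similitude of `J` is a similitude of `-J` with the same multiplier. [folklore] -/
theorem IsSimilitude.neg {J g : Matrix ι ι R} {ν : R} (h : IsSimilitude J ν g) :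
    IsSimilitude (-J) ν g := by
  unfold IsSimilitude at *
  rw [Matrix.mul_neg, Matrix.neg_mul, h, smul_neg]

omit [DecidableEq ι] in
/-- `IsSimilitude (-J) ν g ↔ IsSimilitude J ν g`. [folklore] -/
theorem isSimilitude_neg_iff {J g : Matrix ι ι R} {ν : R} :
    IsSimilitude (-J) ν g ↔ IsSimilitude J ν g :=
  ⟨fun h => by simpa using h.neg, IsSimilitude.neg⟩

omit [Fintype ι] [DecidableEq ι] in
/-- Over a commutative ring in which `2` is not a zero divisor, a skew-symmetric matrix has zero
diagonal. [folklore] -/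
theorem apply_self_eq_zero_of_transpose_eq_neg {J : Matrix ι ι R} (hJt : Jᵀ = -J)
    (h2 : ∀ a : R, 2 * a = 0 → a = 0) (i : ι) : J i i = 0 := by
  have h := apply_eq_neg_apply_of_transpose_eq_neg hJt i i
  refine h2 _ ?_
  rw [two_mul]
  nth_rewrite 1 [h]
  rw [neg_add_cancel]

/-- **Symplectic-with-multiplier representations have a standard form.**  Let `k` be a field with
`2 ≠ 0`, `ρ : Γ_K → GL_{m+m}(k)` framed and `ν : Γ_K → k` any function.  Then
`ρ.IsSymplecticWithMultiplierFun ν` — `ρ(g)ᵀ J ρ(g) = ν(g) J` for some skew-symmetric `J` with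
`det J ∈ kˣ` — holds iff for some `P ∈ GL_{m+m}(k)` every `P⁻¹ ρ(g) P`, re-indexed by
`Fin m ⊕ Fin m ≃ Fin (m + m)`, is a similitude with multiplier `ν(g)` of Mathlib's standard
alternating matrix `Matrix.J (Fin m) k = (0 -1ₘ; 1ₘ 0)`, i.e. `P⁻¹ ρ P` lands in the standard
`GSp_{2m}(k)`.  (⟹: `J` is alternating as `2 ≠ 0`; re-index to `Fin m ⊕ Fin m`, take a symplectic
basis — `exists_transpose_mul_mul_eq_neg_J`, McDuff–Salamon Thm. 2.1.3: `Qᵀ J Q = -J₀` — and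
conjugate by `Q` (`IsSimilitude.conj`, `IsSimilitude.submatrix`, `isSimilitude_neg_iff`).
⟸: transport `J₀` back along the re-indexing and `P⁻¹`.) [cite: McDuffSalamon2017, Thm. 2.1.3]
[cite: BoxerEtAl2021, §2.1.1] -/
theorem FramedGaloisRep.isSymplecticWithMultiplierFun_iff_exists_conj_isSimilitude_matrixJ
    {K : Type*} [Field K] {k : Type*} [Field k] [TopologicalSpace k] (h2 : (2 : k) ≠ 0) {m : ℕ}
    (ρ : FramedGaloisRep K k (m + m)) (ν : absoluteGaloisGroup K → k) :
    ρ.IsSymplecticWithMultiplierFun ν ↔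
      ∃ P : GL (Fin (m + m)) k, ∀ g : absoluteGaloisGroup K,
        IsSimilitude (Matrix.J (Fin m) k) (ν g)
          ((P⁻¹ * ρ g * P).val.submatrix finSumFinEquiv finSumFinEquiv) := by
  have h2' : ∀ a : k, 2 * a = 0 → a = 0 := fun a ha => (mul_eq_zero.mp ha).resolve_left h2
  set e : Fin m ⊕ Fin m ≃ Fin (m + m) := finSumFinEquiv with he
  constructor
  · rintro ⟨J, hJt, hJu, hJ⟩
    have hJs0 : (J.submatrix e e).det ≠ 0 := by
      rw [Matrix.det_submatrix_equiv_self]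
      exact hJu.ne_zero
    have hJst : (J.submatrix e e)ᵀ = -J.submatrix e e := by
      rw [transpose_submatrix, hJt]
      rfl
    obtain ⟨Q, hQ0, hQ⟩ := exists_transpose_mul_mul_eq_neg_J (K := k) (m := m) hJs0 hJst
      (fun i => apply_self_eq_zero_of_transpose_eq_neg hJt h2' (e i))
    have hQu : IsUnit Q.det := isUnit_iff_ne_zero.mpr hQ0
    -- the base change on `Fin (m + m)`
    set P : Matrix (Fin (m + m)) (Fin (m + m)) k := Q.submatrix e.symm e.symm with hP
    have hPu : IsUnit P.det := by
      rw [hP, Matrix.det_submatrix_equiv_self]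
      exact hQu
    refine ⟨Matrix.GeneralLinearGroup.mkOfDetNeZero P hPu.ne_zero, fun g => ?_⟩
    -- `ρ(g)`, re-indexed, is a similitude of `J.submatrix e e`; conjugate by `Q`
    have h1 : IsSimilitude (J.submatrix e e) (ν g) ((ρ g).val.submatrix e e) :=
      (show IsSimilitude J (ν g) (ρ g).val from hJ g).submatrix e
    have h3 := h1.conj (P := Q⁻¹) (Q := Q) (Matrix.mul_nonsing_inv Q hQu)
    rw [hQ, isSimilitude_neg_iff] at h3
    have e1 : ((Matrix.GeneralLinearGroup.mkOfDetNeZero P hPu.ne_zero)⁻¹ * ρ g *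
        Matrix.GeneralLinearGroup.mkOfDetNeZero P hPu.ne_zero).val.submatrix e e =
          Q⁻¹ * (ρ g).val.submatrix e e * Q := by
      rw [Units.val_mul, Units.val_mul, Matrix.coe_units_inv]
      change (P⁻¹ * (ρ g).val * P).submatrix e e = _
      have hPe : P.submatrix e e = Q := by
        rw [hP, submatrix_submatrix, Equiv.symm_comp_self, submatrix_id_id]
      rw [← submatrix_mul_equiv _ _ e e e, ← submatrix_mul_equiv _ _ e e e, hPe,
        ← Matrix.inv_submatrix_equiv P e e, hPe]
    rw [e1]
    exact h3
  · rintro ⟨P, hP⟩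
    have hPi : IsUnit (P⁻¹).val.det := ⟨Matrix.GeneralLinearGroup.det P⁻¹, rfl⟩
    -- the standard form transported to `Fin (m + m)` and along `P⁻¹`
    set J0 : Matrix (Fin (m + m)) (Fin (m + m)) k :=
      (Matrix.J (Fin m) k).submatrix e.symm e.symm with hJ0
    have hJ0t : J0ᵀ = -J0 := by
      rw [hJ0, transpose_submatrix, Matrix.J_transpose]
      rfl
    have hJ0u : IsUnit J0.det := by
      rw [hJ0, Matrix.det_submatrix_equiv_self]
      exact Matrix.isUnit_det_J (Fin m) k
    refine ⟨(P⁻¹).valᵀ * J0 * (P⁻¹).val, transpose_conj_transpose_eq_neg hJ0t _, ?_, fun g => ?_⟩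
    · rw [det_mul, det_mul, det_transpose]
      exact (hPi.mul hJ0u).mul hPi
    · have h1 : IsSimilitude J0 (ν g) (P⁻¹ * ρ g * P).val := by
        have h := (hP g).submatrix e.symm
        rw [submatrix_submatrix, Equiv.self_comp_symm, submatrix_id_id] at h
        exact h
      have h := h1.conj (P := P.val) (Q := (P⁻¹).val)
        (by rw [← Units.val_mul, inv_mul_cancel, Units.val_one])
      have e1 : P.val * (P⁻¹ * ρ g * P).val * (P⁻¹).val = (ρ g).val := by
        rw [← Units.val_mul, ← Units.val_mul]
        congr 1
        group
      rw [e1] at h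
      exact h

/-! ## Appended: `GSp`-valued versus symplectic-with-multiplier

The tree has two hypothesis-level predicates for "lands in a general symplectic group":
`FramedRep.IsGSpValued` (`GSpValued`, multiplier existentially quantified, diagonal clause) and
`FramedGaloisRep.IsSymplecticWithMultiplierFun ρ ν` (`SymplecticMultiplier`, multiplier given).
Over a field with `2 ≠ 0` they agree once `ν` is quantified
(`FramedGaloisRep.isGSpValued_iff_exists_isSymplecticWithMultiplierFun`), whence the standard form
for `IsGSpValued` in even rank (`FramedGaloisRep.isGSpValued_iff_exists_conj_isSimilitude_matrixJ`). -/

/-- **`GSp`-valued ⟺ symplectic with some multiplier function** (over a field with `2 ≠ 0`): the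
tree's two predicates `FramedRep.IsGSpValued ρ` (`GSpValued`: SOME alternating `J` with
`det J ∈ kˣ` and SOME multiplier `ν`) and `FramedGaloisRep.IsSymplecticWithMultiplierFun ρ ν`
(`SymplecticMultiplier`: the same for a GIVEN `ν`, without the diagonal clause) agree once `ν` is
quantified — the diagonal clause is automatic in characteristic `≠ 2`
(`FramedRep.isGSpValued_iff_det_ne_zero`). [cite: BoxerEtAl2021, §2.1.1] -/
theorem FramedGaloisRep.isGSpValued_iff_exists_isSymplecticWithMultiplierFun
    {K : Type*} [Field K] {k : Type*} [Field k] [TopologicalSpace k] [NeZero (2 : k)] {n : ℕ}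
    (ρ : FramedGaloisRep K k n) :
    FramedRep.IsGSpValued ρ ↔
      ∃ ν : absoluteGaloisGroup K → k, ρ.IsSymplecticWithMultiplierFun ν := by
  rw [FramedRep.isGSpValued_iff_det_ne_zero]
  constructor
  · rintro ⟨J, hJ, hJt, ν, hν⟩
    exact ⟨ν, J, hJt, isUnit_iff_ne_zero.mpr hJ, hν⟩
  · rintro ⟨ν, J, hJt, hJu, hν⟩
    exact ⟨J, hJu.ne_zero, hJt, ν, hν⟩

/-- **`GSp`-valued ⟺ conjugate into the standard `GSp_{2m}`** (field with `2 ≠ 0`, rank `m + m`):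
`ρ` is `GSp`-valued iff for some multiplier function `ν` and some `P ∈ GL_{m+m}(k)` every
`P⁻¹ ρ(g) P`, re-indexed by `Fin m ⊕ Fin m ≃ Fin (m + m)`, is a similitude of Mathlib's
`Matrix.J (Fin m) k` with multiplier `ν(g)`
(`isGSpValued_iff_exists_isSymplecticWithMultiplierFun` and
`isSymplecticWithMultiplierFun_iff_exists_conj_isSimilitude_matrixJ`).
[cite: McDuffSalamon2017, Thm. 2.1.3] [cite: BoxerEtAl2021, §2.1.1] -/
theorem FramedGaloisRep.isGSpValued_iff_exists_conj_isSimilitude_matrixJ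
    {K : Type*} [Field K] {k : Type*} [Field k] [TopologicalSpace k] [NeZero (2 : k)] {m : ℕ}
    (ρ : FramedGaloisRep K k (m + m)) :
    FramedRep.IsGSpValued ρ ↔
      ∃ (ν : absoluteGaloisGroup K → k) (P : GL (Fin (m + m)) k), ∀ g : absoluteGaloisGroup K,
        IsSimilitude (Matrix.J (Fin m) k) (ν g)
          ((P⁻¹ * ρ g * P).val.submatrix finSumFinEquiv finSumFinEquiv) := by
  rw [ρ.isGSpValued_iff_exists_isSymplecticWithMultiplierFun]
  exact exists_congr fun ν =>
    ρ.isSymplecticWithMultiplierFun_iff_exists_conj_isSimilitude_matrixJ two_ne_zero ν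

end Literature.NumberTheory.GaloisRepresentations

end
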